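import Literature.MathematicalPhysics.QuantumFieldTheory.ConformalBootstrap3D.PointKernelK34L515.Cert

/-!
# K34L515 instance, cell `l4c2` (parts file: groups 0:32)

Kernel-v3 cell of the point-functional exclusion instance for the lower box `Δσ ∈ [0.515, 0.520]`,
`Δε ∈ [0.6, 0.95)` (certificate `certL515`, module `PointKernelK34L515.Cert`): spin `ℓ = 4`,
`Δ ∈ [21/4, 43/8)` (centre `A`, half-width `2^-4`), Taylor degree `4`, `n_F = 50`, `1` s-piece(s)
covering `s = Δσ ∈ [103/200, 13/25]`.  Group theorems `l4c2_part<i>_<a>_<b> : gPart … = some <literal>` are checked by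
`decide +kernel` (the literals were produced by `#eval` of the same function); the cell numbers `l4c2_num<i> ≥ 0`
likewise; `l4c2_block` is `PKTM.blockPositive_of_cellPass` applied to them. This file holds only group theorems (the cell stated as a literal); the final file of the cell imports it.  Generated by
`gen/mk_v3cell.py` / `gen/drive_v3.py` (typer-g8).  [folklore]
-/

set_option Elab.async false

namespace Literature.MathematicalPhysics.QuantumFieldTheory.ConformalBootstrap3D

namespace PointKernelK34L515

open PointKernel PKTM
open Literature.Analysis.ValidatedNumerics.PolyMP
open Literature.Analysis.ValidatedNumerics.NumericsMP

/-- group model literal [folklore] -/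
def l4c2_g0_32_34 : G3 := ([⟨289677821540162688826502761979203853593, 289677823822053708822872754503301117144⟩, ⟨33987683713848302509542706973804759592, 33987687239105002777743082525565149907⟩, ⟨-2523919892584048927730131313500406860, -2523914831238643436146512152480425802⟩, ⟨2334611809387932059091436016283080756, 2334617456493085307617350260520810725⟩, ⟨-1502378803179981491074197050403259713, -1502373495226086627149326437295637677⟩], [⟨-3510133982997463885491668354985111590, -3510133955871050765385815852271838129⟩, ⟨-387654859090807420016147986937606100, -387654816654696331077733217887649190⟩, ⟨19365758835854393081217927517774245, 19365819778614010757910063665352226⟩, ⟨-24440167076448044681287002086828933, -24440099067964078240253844877791288⟩, ⟨17186500838105090370966061613978728, 17186564772341924612414710808682547⟩], [⟨21434788006198196105818831904901272, 21434788170757802239291319392540856⟩, ⟨2317739480055761611949134206417591, 2317739738643490833241205989426186⟩, ⟨-94659225942625107841386838380300, -94658854525817971514968065288696⟩, ⟨141244205012843134543693319827991, 141244619550130341545587179941018⟩, ⟨-102826207253398596616165039473111, -102825817495726897436222884843828⟩])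

/-- group `[32, 34)` of piece 0 [folklore] -/
theorem l4c2_part0_32_34 : gPart certL515 (⟨4, ((85 : ℚ) / 16), 4, 4, 50, 6, 64, ⟨2, 0, 5, 84, 0, 0⟩⟩ : TMCell) (pc ps1 0) 32 34 = some l4c2_g0_32_34 := by decide +kernel

end PointKernelK34L515

end Literature.MathematicalPhysics.QuantumFieldTheory.ConformalBootstrap3D
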